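import Literature.AlgebraicGeometry.HodgeTheory.FermatShiodaCondition
import Mathlib.Data.ZMod.Units
import HarnessLib

/-!
# Hodge lines and isolated Hodge characters of Fermat varieties; level inflation

Family `hodge`, layer `Literature/AlgebraicGeometry/HodgeTheory`. Third arithmetic brick on the
characters `α : Fin r → ℤ/m` of the diagonal symmetries of the Fermat variety
`X^{r-2}ₘ : x₀ᵐ + ⋯ + x_{r-1}ᵐ = 0` (after `FermatHodgeCharacters`: `normSum / IsHodge / IsPaired`,
and `FermatShiodaCondition`: `IsHodgeMultiset`). Everything here is PROVED; no geometry enters.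
Requested (work item `defn-FermatCharacter.OnHodgeLine`) by the route
`Summits/HodgeConjecture/HodgeConjecture/Theses/GaloisSieve`, whose crux items `CosetAlgebraicity`,
`SporadicAlgebraicity`, `SieveFiniteness` spell the predicate `OnHodgeLine` inline.

* **Level inflation** `FermatCharacter.inflate N : ℤ/m → ℤ/mN`, `a ↦ N·a` (`⟨Na⟩ = N⟨a⟩`), the
  pull-back of characters along `ζ ↦ ζᴺ : μ_{mN} → μₘ`; coordinatewise Aoki–Shioda's passage
  `α' ↦ α = dα'` (level `m' ↦ m = m'd`; Arithmetic and Geometry I (1983) §2, after Theorem (𝔅²ₘ):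
  "set `aᵢ' = aᵢ/d`, `m' = m/d`; then `α' ∈ 𝔅²_{m'}` … `f : X²ₘ → X²_{m'}`, `(xᵢ) ↦ (xᵢᵈ)`, induces
  `f^*V(α') = V(α)`"). PROVED: inflation preserves Hodge multisets / characters
  (`IsHodgeMultiset.map_inflate`, `IsHodge.inflate`: a unit `t` of `ℤ/mN` acts on `N·α` through
  its image `t̄ ∈ (ℤ/m)ˣ`, so `2|t(Nα)|·… = N·(m r) = (mN) r`).
* **Hodge lines.** Theorem (𝔅²ₘ) (loc. cit. (ii); Shioda 1982, Aoki 1983): for `r = 4` every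
  indecomposable Hodge character with `GCD = 1` is, up to permutation, a STANDARD element
  `αᵢ = (i, d+i, m-2i, d)`, `βᵢ = (i, d+i, d+2i, m-4i)` (`m = 2d`), `γⱼ = (j, d+j, 2d+j, m-3j)`
  (`m = 3d`) — one-parameter families uniform in the level — "except for finitely many exceptional
  elements which exist only for `m ≤ 180`". The route abstracts the families (ITS terminology):
  `α` **lies on a Hodge line** (`FermatCharacter.OnHodgeLine`) if for some integer direction
  `v ≠ 0`, `∑ vᵢ = 0`, every level-`mN` character `i ↦ N⟨αᵢ⟩ + mkvᵢ` (`N ≥ 1` prime to `m`,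
  `k ∈ ℤ`; `FermatCharacter.lineChar` = the inflation `N·α` translated by `mkv`) is a Hodge
  character — e.g. formally `N·γ₁ + mk(1, 1, 1, -3)` (level `3d₀`) read at level `3d`, `d = d₀N`,
  is `γⱼ`, `j = N + 3d₀k` — and is **isolated** (`FermatCharacter.IsIsolated`) if it is a Hodge
  character on no Hodge line (for `r = 4` compare the exceptional elements). `OnHodgeLine α` is
  VERBATIM the route items' inline `∃ v, …` (`onHodgeLine_iff` is `Iff.rfl`), for every `r`.
* PROVED: `OnHodgeLine.isHodge` (`N = 1`, `k = 0`); **`IsHodge.onHodgeLine_of_add_eq_zero`,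
  `IsPaired.onHodgeLine`: a Hodge character with a zero-sum pair `αᵢ + αⱼ = 0`, `i ≠ j` (so every
  paired character on `r ≠ 0` coordinates) lies on a Hodge line**, direction `eᵢ - eⱼ` (the
  level-`mN` character is the inflation of `α` off `{i, j}` plus the pair `±(N⟨αᵢ⟩ + mk)`), whence
  isolated characters are pair-free (`IsIsolated.add_ne_zero`) and absent for prime `m`
  (`IsIsolated.eq_zero_of_prime`); invariance of `OnHodgeLine` under permutations (`.compEquiv`),
  units `α ↦ uα` (`.unitSMul`: by the Chinese remainder theorem a unit `t ≡ u (m)`, `t ≡ 1 (N)` of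
  `ℤ/mN` maps the line of `α` onto that of `uα`, same direction), negation (`.neg`) and level
  inflation `α ↦ d·α` (`.inflate`).

NOT here: the classification of Hodge lines (Theorem (𝔅²ₘ) itself, the bound `180`), finiteness
of isolated characters, geometry — these are the route's items.

## References

* [AokiShioda1983] N. Aoki, T. Shioda, Generators of the Néron–Severi group of a Fermat surface,
  in: Arithmetic and Geometry I, Progr. Math. 35 (1983) 1–12, §2: (2.2) (`𝔅²ₘ`), Theorem (𝔅²ₘ)
  (standard / exceptional elements), the `GCD`-reduction `α = dα'` (text read, pp. 2–3).
* [Shioda1979PJA] T. Shioda, The Hodge conjecture and the Tate conjecture for Fermat varieties,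
  Proc. Japan Acad. 55A (1979) 111–114, §1 (action of units and permutations on `𝔅ⁿₘ`).
-/

noncomputable section

open Finset

namespace Literature.AlgebraicGeometry.HodgeTheory

namespace FermatCharacter

variable {m r : ℕ}

/-! ### Level inflation `ℤ/m → ℤ/mN`, `a ↦ N·a` -/

/-- **Level inflation** of a character of `μₘ` to `μ_{mN}` (pull-back along `ζ ↦ ζᴺ`): on
representatives `⟨N·a⟩ = N⟨a⟩`. Coordinatewise, Aoki–Shioda's `α' ↦ α = dα'` (`m = m'd`), induced
on eigenspaces by `f : Xₘ → X_{m'}`, `(xᵢ) ↦ (xᵢᵈ)`, `f^*V(α') = V(α)`.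
[cite: AokiShioda1983, §2 (GCD-reduction after Theorem (𝔅²ₘ))] -/
def inflate (N : ℕ) (a : ZMod m) : ZMod (m * N) := ((N * a.val : ℕ) : ZMod (m * N))

/-- Unfolding `inflate`. [cite: AokiShioda1983, §2] -/
theorem inflate_def (N : ℕ) (a : ZMod m) : inflate N a = ((N * a.val : ℕ) : ZMod (m * N)) := rfl

/-- `⟨N·a⟩ = N⟨a⟩`. [cite: AokiShioda1983, §2] -/
theorem val_inflate [NeZero m] {N : ℕ} (hN : 0 < N) (a : ZMod m) :
    (inflate N a).val = N * a.val := by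
  haveI : NeZero (m * N) := ⟨Nat.mul_ne_zero (NeZero.ne m) hN.ne'⟩
  rw [inflate, ZMod.val_natCast, Nat.mod_eq_of_lt]
  rw [mul_comm m N]
  exact mul_lt_mul_of_pos_left (ZMod.val_lt a) hN

/-- Inflation is injective: `N·a = 0 ↔ a = 0`. [cite: AokiShioda1983, §2] -/
theorem inflate_eq_zero_iff [NeZero m] {N : ℕ} (hN : 0 < N) (a : ZMod m) :
    inflate N a = 0 ↔ a = 0 := by
  constructor
  · intro h
    have hv := congrArg ZMod.val h
    rw [val_inflate hN, ZMod.val_zero] at hv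
    exact (ZMod.val_eq_zero a).mp ((Nat.mul_eq_zero.mp hv).resolve_left hN.ne')
  · rintro rfl
    simp [inflate]

/-- Inflation commutes with negation (`⟨-a⟩ = m - ⟨a⟩`). [folklore] -/
theorem inflate_neg [NeZero m] (N : ℕ) (a : ZMod m) : inflate N (-a) = -inflate N a := by
  rcases eq_or_ne a 0 with rfl | ha
  · simp [inflate]
  · rw [inflate, inflate, ZMod.neg_val, if_neg ha, eq_neg_iff_add_eq_zero, ← Nat.cast_add,
      ZMod.natCast_eq_zero_iff]
    refine ⟨1, ?_⟩
    rw [← Nat.mul_add, Nat.sub_add_cancel (ZMod.val_lt a).le]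
    ring

/-- `t · (N·a) = N·(t̄ a)` for `t ∈ ℕ` (`t̄ = t mod m`): `tN⟨a⟩ ≡ N⟨ta⟩ (mod mN)`. [folklore] -/
theorem natCast_mul_inflate {N : ℕ} (t : ℕ) (a : ZMod m) :
    (t : ZMod (m * N)) * inflate N a = inflate N ((t : ZMod m) * a) := by
  rcases Nat.eq_zero_or_pos m with rfl | hm
  · -- `m = 0`: `ℤ/0 = ℤ`, and `0 * N = 0`
    simp only [inflate]
    push_cast
    rw [ZMod.val_mul, Nat.mod_zero, ZMod.val_natCast, Nat.mod_zero]
    push_cast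
    ring
  haveI : NeZero m := NeZero.of_pos hm
  rw [inflate, inflate, ← Nat.cast_mul, ZMod.natCast_eq_natCast_iff', ZMod.val_mul,
    ZMod.val_natCast, Nat.mod_mul_mod]
  have h1 : t * (N * a.val) % (m * N) = N * (t * a.val % m) := by
    rw [mul_left_comm, mul_comm m N, Nat.mul_mod_mul_left]
  have h2 : N * (t * a.val % m) % (m * N) = N * (t * a.val % m) := by
    rw [mul_comm m N, Nat.mul_mod_mul_left, Nat.mod_mod]
  rw [h1, h2]

/-- A unit `t` of `ℤ/mN` acts on inflated characters through its image `t̄ ∈ (ℤ/m)ˣ`: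
`t · (N·a) = N·(t̄ a)`. [folklore] -/
theorem unit_mul_inflate [NeZero m] {N : ℕ} (hN : 0 < N) (t : (ZMod (m * N))ˣ) (a : ZMod m) :
    (t : ZMod (m * N)) * inflate N a =
      inflate N ((ZMod.unitsMap (dvd_mul_right m N) t : ZMod m) * a) := by
  haveI : NeZero (m * N) := ⟨Nat.mul_ne_zero (NeZero.ne m) hN.ne'⟩
  have ht : ((t : ZMod (m * N)) : ZMod (m * N)) = (((t : ZMod (m * N)).val : ℕ) : ZMod (m * N)) :=
    (ZMod.natCast_zmod_val _).symm
  rw [ZMod.unitsMap_val, ZMod.cast_eq_val]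
  conv_lhs => rw [ht]
  exact natCast_mul_inflate _ a

/-- **Inflation preserves Hodge multisets**: all `N·a ≠ 0`, `∑ N·aᵢ = N·m|α| ≡ 0`, and
`2|t·(Nα)| = 2N·(m|t̄α|)/… = (mN)·r` for every unit `t` of `ℤ/mN`.
[cite: AokiShioda1983, §2 ("α' is an element of 𝔅²_{m'}" under the GCD-reduction)] -/
theorem IsHodgeMultiset.map_inflate [NeZero m] {N : ℕ} (hN : 0 < N) {s : Multiset (ZMod m)}
    (h : IsHodgeMultiset s) : IsHodgeMultiset (s.map (inflate N)) := by
  haveI : NeZero (m * N) := ⟨Nat.mul_ne_zero (NeZero.ne m) hN.ne'⟩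
  have hnorm : ∀ u : Multiset (ZMod m), mNormSum (u.map (inflate N)) = N * mNormSum u := by
    intro u
    simp only [mNormSum, Multiset.map_map, Function.comp_def, val_inflate hN]
    rw [Multiset.sum_map_mul_left]
  refine ⟨⟨?_, ?_⟩, fun t ↦ ?_⟩
  · intro b hb
    obtain ⟨a, ha, rfl⟩ := Multiset.mem_map.mp hb
    exact (inflate_eq_zero_iff hN a).not.mpr (h.1.1 a ha)
  · -- `∑ N·aᵢ = N · m|α|` and `m ∣ m|α|` because `∑ aᵢ = 0`
    have hsum : (s.map (inflate N)).sum = ((N * mNormSum s : ℕ) : ZMod (m * N)) := by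
      rw [mNormSum, ← Multiset.sum_map_mul_left, Nat.cast_multiset_sum, Multiset.map_map]
      rfl
    have hdvd : m ∣ mNormSum s := by
      rw [← ZMod.natCast_eq_zero_iff]
      have : ((mNormSum s : ℕ) : ZMod m) = s.sum := by simp [mNormSum]
      rw [this, h.1.2]
    rw [hsum, ZMod.natCast_eq_zero_iff]
    exact mul_comm N m ▸ Nat.mul_dvd_mul_left N hdvd
  · have hmap : (s.map (inflate N)).map (fun b ↦ (t : ZMod (m * N)) * b) =
        (s.map fun a ↦ (ZMod.unitsMap (dvd_mul_right m N) t : ZMod m) * a).map (inflate N) := by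
      rw [Multiset.map_map, Multiset.map_map]
      exact Multiset.map_congr rfl fun a _ ↦ unit_mul_inflate hN t a
    rw [hmap, hnorm, Multiset.card_map, mul_left_comm, h.2]
    ring

/-- **Inflation preserves Hodge characters.** [cite: AokiShioda1983, §2 (GCD-reduction)] -/
theorem IsHodge.inflate [NeZero m] {N : ℕ} (hN : 0 < N) {α : Fin r → ZMod m} (h : IsHodge α) :
    IsHodge fun i ↦ inflate N (α i) := by
  rw [isHodge_iff_isHodgeMultiset] at h ⊢
  have : univ.val.map (fun i ↦ FermatCharacter.inflate N (α i)) =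
      (univ.val.map α).map (FermatCharacter.inflate N) := by
    rw [Multiset.map_map]
    rfl
  rw [this]
  exact h.map_inflate hN

/-- Transport of `IsHodge` along an equality of levels (`ℤ/n₁ = ℤ/n₂` for `n₁ = n₂`). [folklore] -/
theorem IsHodge.cast_of_eq {n₁ n₂ : ℕ} (h : n₁ = n₂) {α : Fin r → ZMod n₁} (hα : IsHodge α) :
    IsHodge fun i ↦ ((α i).cast : ZMod n₂) := by
  subst h
  simpa only [ZMod.cast_id] using hα

/-! ### Line characters, Hodge lines, isolated characters -/

/-- The **level-`mN` character of the line through `α` in direction `v`** at the parameter `k`: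
`i ↦ N⟨αᵢ⟩ + m k vᵢ (mod mN)`, i.e. the inflation `N·α` translated by `m k v`
(`lineChar_eq_inflate_add`). [cite: AokiShioda1983, §2 Theorem (𝔅²ₘ) (ii) (the standard families)] -/
def lineChar (α : Fin r → ZMod m) (v : Fin r → ℤ) (N : ℕ) (k : ℤ) : Fin r → ZMod (m * N) :=
  fun i ↦ (((N : ℤ) * ((α i).val : ℤ) + (m : ℤ) * k * v i : ℤ) : ZMod (m * N))

/-- Unfolding `lineChar`. [cite: AokiShioda1983, §2] -/
theorem lineChar_apply (α : Fin r → ZMod m) (v : Fin r → ℤ) (N : ℕ) (k : ℤ) (i : Fin r) :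
    lineChar α v N k i = (((N : ℤ) * ((α i).val : ℤ) + (m : ℤ) * k * v i : ℤ) : ZMod (m * N)) :=
  rfl

/-- `lineChar α v N k = N·α + m k v`: inflation translated by `m k v`. [folklore] -/
theorem lineChar_eq_inflate_add (α : Fin r → ZMod m) (v : Fin r → ℤ) (N : ℕ) (k : ℤ) (i : Fin r) :
    lineChar α v N k i = inflate N (α i) + (((m : ℤ) * k * v i : ℤ) : ZMod (m * N)) := by
  rw [lineChar_apply, inflate_def]
  push_cast
  ring

/-- Reduction mod `m` of the line character: `N⟨αᵢ⟩ + m k vᵢ ≡ N αᵢ (mod m)`. [folklore] -/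
theorem castHom_lineChar [NeZero m] (α : Fin r → ZMod m) (v : Fin r → ℤ) (N : ℕ) (k : ℤ) (i : Fin r) :
    ZMod.castHom (dvd_mul_right m N) (ZMod m) (lineChar α v N k i) = (N : ZMod m) * α i := by
  rw [lineChar_apply, map_intCast]
  push_cast
  rw [ZMod.natCast_self, zero_mul, zero_mul, add_zero, ZMod.natCast_zmod_val]

/-- The line character has non-zero coordinates wherever `α` has, for `N` prime to `m`.
[folklore] -/
theorem lineChar_ne_zero [NeZero m] {α : Fin r → ZMod m} {N : ℕ} (hNm : Nat.Coprime N m) {i : Fin r}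
    (hα : α i ≠ 0) (v : Fin r → ℤ) (k : ℤ) : lineChar α v N k i ≠ 0 := by
  intro h0
  have h1 := castHom_lineChar α v N k i
  rw [h0, map_zero] at h1
  exact hα ((Units.mul_right_eq_zero (ZMod.unitOfCoprime N hNm)).mp h1.symm)

/-- **`α` lies on a Hodge line** (route `GaloisSieve`, items `CosetAlgebraicity` /
`SporadicAlgebraicity` / `SieveFiniteness`, verbatim): there is an integer direction `v ≠ 0` with
`∑ vᵢ = 0` such that for every level multiplier `N ≥ 1` prime to `m` and every `k ∈ ℤ` the
level-`mN` character `i ↦ N⟨αᵢ⟩ + m k vᵢ` is a Hodge character — `α` belongs to a one-parameter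
family of Hodge characters uniform in the level, as Aoki–Shioda's standard elements
`αᵢ, βᵢ, γⱼ` do for `r = 4`. [cite: AokiShioda1983, §2 Theorem (𝔅²ₘ) (ii) (standard elements); the ∃v-abstraction is the route's] -/
def OnHodgeLine (α : Fin r → ZMod m) : Prop :=
  ∃ v : Fin r → ℤ, v ≠ 0 ∧ ∑ i, v i = 0 ∧
    ∀ N : ℕ, 0 < N → Nat.Coprime N m → ∀ k : ℤ, IsHodge (lineChar α v N k)

/-- `OnHodgeLine` is literally the inline predicate of the route items (`Iff.rfl`).
[cite: AokiShioda1983, §2 Theorem (𝔅²ₘ) (ii)] -/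
theorem onHodgeLine_iff (α : Fin r → ZMod m) :
    OnHodgeLine α ↔ ∃ v : Fin r → ℤ, v ≠ 0 ∧ ∑ i, v i = 0 ∧ ∀ N : ℕ, 0 < N → Nat.Coprime N m →
      ∀ k : ℤ, IsHodge (fun i => (((N : ℤ) * ((α i).val : ℤ) + (m : ℤ) * k * v i : ℤ) :
        ZMod (m * N))) :=
  Iff.rfl

/-- **`α` is isolated**: a Hodge character lying on no Hodge line (route `GaloisSieve`; for
`r = 4` compare Aoki–Shioda's "exceptional elements", which exist only for `m ≤ 180`).
[cite: AokiShioda1983, §2 Theorem (𝔅²ₘ) (ii) (exceptional elements); the abstraction is the route's] -/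
def IsIsolated (α : Fin r → ZMod m) : Prop := IsHodge α ∧ ¬ OnHodgeLine α

/-- A character on a Hodge line is a Hodge character (the point `N = 1`, `k = 0` of the line
is `α` itself). [folklore] -/
theorem OnHodgeLine.isHodge [NeZero m] {α : Fin r → ZMod m} (h : OnHodgeLine α) : IsHodge α := by
  obtain ⟨v, -, -, hv⟩ := h
  have h1 := (hv 1 one_pos (Nat.coprime_one_left m) 0).cast_of_eq (mul_one m)
  convert h1 using 1
  funext i
  simp only [lineChar_apply, Nat.cast_one, one_mul, mul_zero, zero_mul, add_zero, Int.cast_natCast]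
  rw [ZMod.cast_natCast (dvd_mul_right m 1), ZMod.natCast_zmod_val]

/-! ### Zero-sum pairs: paired characters lie on Hodge lines -/

/-- **A Hodge character with a zero-sum pair `αᵢ + αⱼ = 0` (`i ≠ j`) lies on a Hodge line**, in
the pair direction `v = eᵢ - eⱼ`: at level `mN` the character is the inflation `N·α` off
`{i, j}` — a Hodge multiset — juxtaposed with the pair `±(N⟨αᵢ⟩ + mk)`, non-zero because
`N⟨αᵢ⟩ + mk ≡ Nαᵢ ≢ 0 (mod m)`. [folklore] -/
theorem IsHodge.onHodgeLine_of_add_eq_zero [NeZero m] {α : Fin r → ZMod m} (h : IsHodge α)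
    {i j : Fin r} (hij : i ≠ j) (hα : α i + α j = 0) : OnHodgeLine α := by
  classical
  set v : Fin r → ℤ := Pi.single i 1 - Pi.single j 1 with hv
  have hvi : v i = 1 := by simp [hv, hij]
  have hvj : v j = -1 := by simp [hv, Ne.symm hij]
  have hvl : ∀ l, l ≠ i → l ≠ j → v l = 0 := fun l hli hlj ↦ by
    simp [hv, hli, hlj]
  refine ⟨v, fun h0 ↦ ?_, ?_, fun N hN hNm k ↦ ?_⟩
  · have := congrFun h0 i
    rw [hvi] at this
    exact one_ne_zero this
  · simp only [hv, Pi.sub_apply, Finset.sum_sub_distrib, Finset.sum_pi_single', Finset.mem_univ,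
      if_true, sub_self]
  · haveI : NeZero (m * N) := ⟨Nat.mul_ne_zero (NeZero.ne m) hN.ne'⟩
    set β := lineChar α v N k with hβ
    have hαj : α j = -α i := eq_neg_of_add_eq_zero_right hα
    have hβj : β j = -β i := by
      rw [hβ, lineChar_eq_inflate_add, lineChar_eq_inflate_add, hvi, hvj, hαj, inflate_neg]
      push_cast
      ring
    have hβl : ∀ l, l ≠ i → l ≠ j → β l = FermatCharacter.inflate N (α l) := fun l hli hlj ↦ by
      rw [hβ, lineChar_eq_inflate_add, hvl l hli hlj]
      push_cast
      ring
    -- split the index set as `{i, j} ⊔ rest`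
    set R : Finset (Fin r) := (univ.erase i).erase j with hR
    have hjR : j ∉ R := Finset.notMem_erase j _
    have hiR : i ∉ insert j R := by simp [hR, hij]
    have huniv : (univ : Finset (Fin r)) = insert i (insert j R) := by
      rw [hR, Finset.insert_erase (Finset.mem_erase.mpr ⟨Ne.symm hij, Finset.mem_univ j⟩),
        Finset.insert_erase (Finset.mem_univ i)]
    have hsplit : ∀ γ : Fin r → ZMod (m * N), univ.val.map γ = γ i ::ₘ (γ j ::ₘ R.val.map γ) := by
      intro γ
      rw [huniv, Finset.insert_val_of_notMem hiR, Finset.insert_val_of_notMem hjR,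
        Multiset.map_cons, Multiset.map_cons]
    have hsplitα : univ.val.map α = ({α i, -α i} : Multiset (ZMod m)) + R.val.map α := by
      rw [pair_add_eq_cons_cons, huniv, Finset.insert_val_of_notMem hiR,
        Finset.insert_val_of_notMem hjR, Multiset.map_cons, Multiset.map_cons, hαj]
    -- the rest of `α` is a Hodge multiset, hence so is its inflation
    have hrest : IsHodgeMultiset ((R.val.map α).map (FermatCharacter.inflate N)) := by
      have hs := h.isHodgeMultiset
      rw [hsplitα] at hs
      exact hs.of_pair_add.map_inflate hN
    have hmapR : R.val.map β = (R.val.map α).map (FermatCharacter.inflate N) := by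
      rw [Multiset.map_map]
      refine Multiset.map_congr rfl fun l hl ↦ ?_
      have hl' := hl
      rw [hR, Finset.mem_val, Finset.mem_erase, Finset.mem_erase] at hl'
      exact hβl l hl'.2.1 hl'.1
    rw [isHodge_iff_isHodgeMultiset, hsplit β, hβj, hmapR, ← pair_add_eq_cons_cons]
    exact (IsHodgeMultiset.pair (lineChar_ne_zero hNm (h.1.1 i) v k)).add hrest

/-- **Paired characters (with non-zero coordinates, on `r ≠ 0` indices) lie on Hodge lines.**
[folklore] -/
theorem IsPaired.onHodgeLine [NeZero m] {α : Fin r → ZMod m} (h : IsPaired α) (hα : ∀ i, α i ≠ 0)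
    (hr : r ≠ 0) : OnHodgeLine α := by
  obtain ⟨σ, hσ1, -, hσα⟩ := id h
  have i : Fin r := ⟨0, Nat.pos_of_ne_zero hr⟩
  exact (h.isHodge hα).onHodgeLine_of_add_eq_zero (hσ1 i) (by rw [hσα i, neg_add_cancel])

/-- **Isolated characters are pair-free**: `αᵢ + αⱼ ≠ 0` for `i ≠ j`. [folklore] -/
theorem IsIsolated.add_ne_zero [NeZero m] {α : Fin r → ZMod m} (h : IsIsolated α) {i j : Fin r}
    (hij : i ≠ j) : α i + α j ≠ 0 :=
  fun h0 ↦ h.2 (h.1.onHodgeLine_of_add_eq_zero hij h0)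

/-- For `m = p` prime there are no isolated characters on `r ≠ 0` coordinates (every Hodge
character is paired, `IsHodge.isPaired`). [cite: Ran1980, Prop. 1.8 (i)] -/
theorem IsIsolated.eq_zero_of_prime {p : ℕ} [Fact p.Prime] {α : Fin r → ZMod p}
    (h : IsIsolated α) : r = 0 := by
  by_contra hr
  exact h.2 (h.1.isPaired.onHodgeLine h.1.1.1 hr)

/-! ### Invariance under permutations, units, negation and level inflation -/

/-- Hodge lines are permuted with the coordinates. [cite: Shioda1979PJA, §1] -/
theorem OnHodgeLine.compEquiv {α : Fin r → ZMod m} (h : OnHodgeLine α) (π : Equiv.Perm (Fin r)) :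
    OnHodgeLine (α ∘ π) := by
  obtain ⟨v, hv0, hvs, hv⟩ := h
  refine ⟨v ∘ π, fun h0 ↦ hv0 ?_, ?_, fun N hN hNm k ↦ ?_⟩
  · funext l
    have := congrFun h0 (π.symm l)
    simpa using this
  · rw [← hvs]
    exact Equiv.sum_comp π v
  · exact (hv N hN hNm k).compEquiv π

/-- **Hodge lines are stable under the units `α ↦ uα`** (same direction `v`): by the Chinese
remainder theorem pick `t ∈ ℕ` with `t ≡ u (mod m)`, `t ≡ 1 (mod N)`; then `t` is a unit of
`ℤ/mN` and `t · (N·α + m k v) = N·(uα) + m k v`. [cite: Shioda1979PJA, §1] -/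
theorem OnHodgeLine.unitSMul [NeZero m] {α : Fin r → ZMod m} (h : OnHodgeLine α) (u : (ZMod m)ˣ) :
    OnHodgeLine fun i ↦ (u : ZMod m) * α i := by
  obtain ⟨v, hv0, hvs, hv⟩ := h
  refine ⟨v, hv0, hvs, fun N hN hNm k ↦ ?_⟩
  haveI : NeZero (m * N) := ⟨Nat.mul_ne_zero (NeZero.ne m) hN.ne'⟩
  obtain ⟨t, htm, htN⟩ := Nat.chineseRemainder hNm.symm (u : ZMod m).val 1
  have htcop : Nat.Coprime t (m * N) := by
    refine Nat.Coprime.mul_right ?_ ?_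
    · rw [Nat.Coprime, htm.gcd_eq]
      exact ZMod.val_coe_unit_coprime u
    · rw [Nat.Coprime, htN.gcd_eq, Nat.gcd_one_left]
  have hmt : (t : ZMod (m * N)) * (m : ZMod (m * N)) = (m : ZMod (m * N)) := by
    rw [← Nat.cast_mul, ZMod.natCast_eq_natCast_iff, Nat.mul_comm t m]
    simpa using htN.mul_left' m
  have key : lineChar (fun i ↦ (u : ZMod m) * α i) v N k =
      fun i ↦ (ZMod.unitOfCoprime t htcop : ZMod (m * N)) * lineChar α v N k i := by
    funext i
    rw [ZMod.coe_unitOfCoprime, lineChar_eq_inflate_add, lineChar_eq_inflate_add, mul_add,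
      natCast_mul_inflate, (ZMod.natCast_eq_natCast_iff _ _ _).mpr htm, ZMod.natCast_zmod_val]
    congr 1
    push_cast
    rw [show (t : ZMod (m * N)) * ((m : ZMod (m * N)) * (k : ZMod (m * N)) * (v i : ZMod (m * N)))
        = (t : ZMod (m * N)) * (m : ZMod (m * N)) * (k : ZMod (m * N)) * (v i : ZMod (m * N)) by
          ring, hmt]
  rw [key]
  exact (hv N hN hNm k).unitSMul _

/-- Hodge lines are stable under negation `α ↦ -α` (complex conjugation). [folklore] -/
theorem OnHodgeLine.neg [NeZero m] {α : Fin r → ZMod m} (h : OnHodgeLine α) : OnHodgeLine (-α) := by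
  have := h.unitSMul (-1)
  simp only [Units.val_neg, Units.val_one, neg_mul, one_mul] at this
  exact this

/-- Inflating by `d` the level-`mN` line character of `α` gives the level-`(md)N` line character
of `d·α` with the same direction and parameter (read in `ℤ/mdN`):
`d·(N⟨αᵢ⟩ + mkvᵢ mod mN) ≡ N·(d⟨αᵢ⟩) + (md)kvᵢ (mod mdN)`. [folklore] -/
theorem cast_inflate_lineChar [NeZero m] {N d : ℕ} (hN : 0 < N) (hd : 0 < d) (α : Fin r → ZMod m)
    (v : Fin r → ℤ) (k : ℤ) (i : Fin r) :
    ((inflate d (lineChar α v N k i)).cast : ZMod (m * d * N)) =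
      lineChar (fun j ↦ inflate d (α j)) v N k i := by
  haveI : NeZero (m * N) := ⟨Nat.mul_ne_zero (NeZero.ne m) hN.ne'⟩
  haveI : NeZero (m * d) := ⟨Nat.mul_ne_zero (NeZero.ne m) hd.ne'⟩
  haveI : NeZero (m * N * d) := ⟨Nat.mul_ne_zero (NeZero.ne (m * N)) hd.ne'⟩
  rw [ZMod.cast_eq_val, val_inflate hd, lineChar_apply, lineChar_apply, val_inflate hd]
  set x : ℤ := (N : ℤ) * ((α i).val : ℤ) + (m : ℤ) * k * v i with hx
  have hX : (((x : ZMod (m * N)).val : ℕ) : ℤ) = x % ((m * N : ℕ) : ℤ) := ZMod.val_intCast x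
  have hdiv := Int.emod_add_mul_ediv x ((m * N : ℕ) : ℤ)
  rw [← Int.cast_natCast (R := ZMod (m * d * N)) (d * _)]
  simp only [Nat.cast_mul]
  rw [hX, ZMod.intCast_eq_intCast_iff_dvd_sub]
  refine ⟨x / ((m * N : ℕ) : ℤ), ?_⟩
  push_cast at hdiv ⊢
  linear_combination (-(d : ℤ)) * hdiv - (d : ℤ) * hx

/-- **Hodge lines are stable under level inflation `α ↦ d·α`** (same direction): the level-`mdN`
character of `d·α` is the inflation by `d` of the level-`mN` character of `α`.
[cite: AokiShioda1983, §2 (GCD-reduction)] -/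
theorem OnHodgeLine.inflate [NeZero m] {α : Fin r → ZMod m} (h : OnHodgeLine α) {d : ℕ}
    (hd : 0 < d) : OnHodgeLine fun i ↦ inflate d (α i) := by
  obtain ⟨v, hv0, hvs, hv⟩ := h
  refine ⟨v, hv0, hvs, fun N hN hNmd k ↦ ?_⟩
  have hNm : Nat.Coprime N m := Nat.Coprime.coprime_mul_right_right hNmd
  haveI : NeZero (m * N) := ⟨Nat.mul_ne_zero (NeZero.ne m) hN.ne'⟩
  have h1 := ((hv N hN hNm k).inflate hd).cast_of_eq (show m * N * d = m * d * N by ring)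
  convert h1 using 1
  funext i
  exact (cast_inflate_lineChar hN hd α v k i).symm

end FermatCharacter

end Literature.AlgebraicGeometry.HodgeTheory

end
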